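import Literature.MathematicalPhysics.QuantumLattice.TIGroundEnergyDensityResponse
import Literature.MathematicalPhysics.QuantumLattice.HubbardTTPrimeGrandCanonicalEnergyDensity
import HarnessLib

/-!
# The GRAND-CANONICAL-class sourced chord FLOOR for translation-invariant states of `ℤ²`:
# a `μ`-floor at `h = 0` and a sourced cap at `h` bound the pinning-field response from below

HONEST FRAMING: zero compute; nothing here is a number of record by itself — every bound takes certified rows as
HYPOTHESES (a grand-canonical source-free `μ`-floor `c ≤ p(1,t′,U,μ) = gcEnergyDensityTT' 1 t′ U μ`, or the TANGENT
of a canonical certificate, and a sourced CAP `u`); the conclusion is a floor on the FINITE-FIELD pairing response of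
translation-invariant infinite-volume states at a fixed source `h > 0` and a fixed chemical potential `μ` — «finite-h
response (certified)» (cell wording W1), NOT an order parameter, NOT a statement at `h → 0`, NOT a superconductivity
verdict.

Venture `CertifiedManyBodySolver`, cell `hubbard-cq` (rung CQ, CQ-TABLE §B1 / §B1-U), seat `hubbard-cq-obsth-3` (row
«Hellmann–Feynman bracket → m_d(h) two-sided node»). This is the grand-canonical TWIN of
`TISourcedMinimiserChordFloor.lean` (hubbard-cq-p2: the CANONICAL class, density fixed by hypothesis, `μ = 0` pencil,
premise = a one-density canonical floor such as node #473) and the infinite-volume form of `PinningFieldTangentChord.lean`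
(finite tori). OBJECTS (all in the tree): translation-invariant `ω : InfVolFermionState 2`, the sourced pencil
`hubbardTTPrimeSourcedInteraction t t′ U μ g h` with mean energy `E^{μ}_h(ω) = e^{tt′}(ω) − μρ(ω) − h·e_P(ω)`
(`meanEnergy_hubbardTTPrimeSourced`), `e_{P_d}(ω) = 2·Re ω(P₀^d)` (`meanEnergy_pairSourceInteraction_dWave_eq`), the
every-state Griffiths chord `div_le_pairAmplitude_of_bounds`, the grand-canonical energy density
`p = gcEnergyDensityTT' t t′ U μ = inf_m (e(m) − μm)` and its variational principle
`IsTranslationInvariant.gcEnergyDensityTT'_le_meanEnergy_sub` (`p(μ) ≤ e^{tt′}(ω) − μρ(ω)` for `ρ(ω) ∈ (0,2)`, `U ≥ 0`).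

* §1 `pairAmplitude_ge_of_gcFloor_of_sourced_le` — EVERY translation-invariant `ω` with `ρ(ω) ∈ (0,2)` and
  `E^{μ}_h(ω) ≤ u`, given a `μ`-floor `c ≤ p(1,t′,U,μ)`: `(c − u)/h ≤ e_P(ω)`, i.e. `(c − u)/(2h) ≤ Re ω(P₀^d)`
  (`re_expect_localPairAt_ge_of_gcFloor_of_sourced_le`). Three lines: `E^{μ}_0(ω) ≥ p(μ) ≥ c`, `E^{μ}_h(ω) ≤ u`,
  `E^{μ}_0 − E^{μ}_h = h·e_P`.
* §2 THE TANGENT READING (what «P-GC(μ*)» means in tree vocabulary): a canonical certificate at density `n` with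
  filling multiplier `μ` proves the tangent `ℓ + μ(m − n) ≤ e(1,t′,U,m)` at EVERY density `m ∈ (0,2)`; that tangent IS
  the `μ`-floor `ℓ − μn ≤ p(1,t′,U,μ)` (`gcFloor_of_tangent`, by `le_gcEnergyDensityTT'_of_Ioo`). With a cap stated on
  the `μ = 0` pencil for a state of density EXACTLY `n` (`E^{0}_h(σ) ≤ u₀`, e.g. a cluster mixture), the `μ`-pencil
  cap is `u₀ − μn` (`meanEnergy_hubbardTTPrimeSourced_mu_eq`) and the `μ`-terms CANCEL in the floor:
  `(ℓ − u₀)/(2h) ≤ Re ω(P₀^d)` for every translation-invariant `ω` of density `n` (then both classes give the same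
  number) — `re_expect_localPairAt_ge_of_tangent_of_sourced_le_sameDensity`.
* §3 the ε-MINIMISER form over the GRAND-CANONICAL class `{ω translation invariant, 0 < ρ(ω) < 2}` at fixed `μ`
  (`re_expect_localPairAt_ge_of_gcEpsMinimiser`, `exists_epsMinimiser_gcClass`): if SOME state of the class has
  `E^{μ}_h ≤ u` then every ε-minimiser has `(c − u − ε)/(2h) ≤ Re ω(P₀^d)`. The density of a grand-canonical minimiser
  drifts with `h` at fixed `μ` (contrast: the canonical class fixes the density and lets `μ` drift).
* §4 the `(t′, U) = (0, 8)` instance at the tangent chemical potential of CERTIFIED #473, `μ₄₇₃ = 980464777135/2³⁹`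
  (`re_expect_localPairAt_ge_anchor473_gc`): premise `hμ : ℓ₄₇₃ − (7/8)μ₄₇₃ ≤ gcEnergyDensityTT' 1 0 8 μ₄₇₃` (the
  grand-canonical reading of #473's dual — NOT the landed one-density node, which does not imply it) + a cap `u` on the
  state's own `E^{μ₄₇₃}_h` ⇒ `((ℓ₄₇₃ − (7/8)μ₄₇₃) − u)/(2h) ≤ Re ω(P₀^d)`; with `u = u₀ − (7/8)μ₄₇₃` this is
  `(ℓ₄₇₃ − u₀)/(2h)`, the number of the canonical route.

No definition, no named fact, no `sorry`.

References: R. B. Griffiths, Phys. Rev. 152 (1966) 240, §II [cite: Griffiths1966, §II]; T. Koma, H. Tasaki, J. Stat.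
Phys. 76 (1994) 745, §1 [cite: KomaTasaki1994, §1]; D. Ruelle, *Statistical Mechanics* (1969) §3.4 (grand-canonical
function = Legendre transform in the density) [cite: Ruelle1969, §3.4]; O. Bratteli, A. Kishimoto, D. W. Robinson,
Commun. Math. Phys. 64 (1978) 41, §3 Thm. 2 [cite: BratteliKishimotoRobinson1978, §3 Thm. 2].
-/

noncomputable section

namespace Summit.Ventures.CertifiedManyBodySolver.Observables

open Literature.MathematicalPhysics.QuantumLattice Literature.Probability.LatticeModels
open InfVolFermionState ThermodynamicLimit
open scoped Matrix.Norms.L2Operator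

/-! ### §1 The grand-canonical chord floor for every translation-invariant state -/

section EveryState

variable {ω : InfVolFermionState 2} {t' U μ h c u : ℝ} {g : Site 2 → ℝ}

/-- **Grand-canonical chord floor, every state.** Let `ω` be translation invariant with density in `(0,2)`,
`U ≥ 0`, `h > 0`. If `c ≤ p(1,t′,U,μ)` (a certified grand-canonical source-free floor at chemical potential `μ`) and
the state's own sourced energy satisfies `E^{μ}_h(ω) = ω.meanEnergy (hubbardTTPrimeSourcedInteraction 1 t' U μ g h) 1 ≤ u`,
then `(c − u)/h ≤ e_P(ω)`. (Grand-canonical variational principle `p(μ) ≤ e^{tt′}(ω) − μρ(ω)`, then the Griffiths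
chord `div_le_pairAmplitude_of_bounds` with `δ = h`.) [cite: Griffiths1966, §II] [cite: BratteliKishimotoRobinson1978, §3 Thm. 2] -/
theorem pairAmplitude_ge_of_gcFloor_of_sourced_le (hω : ω.IsTranslationInvariant) (hU : 0 ≤ U)
    (hρ0 : 0 < ω.density) (hρ2 : ω.density < 2) (hh : 0 < h)
    (hc : c ≤ gcEnergyDensityTT' 1 t' U μ)
    (hu : ω.meanEnergy (hubbardTTPrimeSourcedInteraction 1 t' U μ g h) 1 ≤ u) :
    (c - u) / h ≤ ω.meanEnergy (pairSourceInteraction g) 1 := by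
  have hvar := hω.gcEnergyDensityTT'_le_meanEnergy_sub 1 t' hU μ hρ0 hρ2
  have hlo : c ≤ ω.meanEnergy (hubbardTTPrimeSourcedInteraction 1 t' U μ g (h - h)) 1 := by
    rw [meanEnergy_hubbardTTPrimeSourced, sub_self, zero_mul, sub_zero]
    exact hc.trans hvar
  exact ω.div_le_pairAmplitude_of_bounds hh hlo hu

/-- The same in the cell's response convention `m(ω) = Re ω(P₀^d)` (`e_{P_d} = 2m`): for the `d`-wave source,
`(c − u)/(2h) ≤ Re ω(P₀^d)`. [cite: Griffiths1966, §II] [cite: KomaTasaki1994, §1] -/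
theorem re_expect_localPairAt_ge_of_gcFloor_of_sourced_le (hω : ω.IsTranslationInvariant) (hU : 0 ≤ U)
    (hρ0 : 0 < ω.density) (hρ2 : ω.density < 2) (hh : 0 < h)
    (hc : c ≤ gcEnergyDensityTT' 1 t' U μ)
    (hu : ω.meanEnergy (hubbardTTPrimeSourcedInteraction 1 t' U μ dWaveFormFactor h) 1 ≤ u) :
    (c - u) / (2 * h) ≤
      (ω.expect (pairRegion (insert 0 unitSteps) 0) (localPairAt (insert 0 unitSteps) dWaveFormFactor 0)).re := by
  have h1 := pairAmplitude_ge_of_gcFloor_of_sourced_le hω hU hρ0 hρ2 hh hc hu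
  rw [meanEnergy_pairSourceInteraction_dWave_eq] at h1
  rw [div_le_iff₀ (by positivity)]
  rw [div_le_iff₀ hh] at h1
  linarith

end EveryState

/-! ### §2 The tangent reading of a canonical certificate: `μ`-floor, and the `μ`-cancellation -/

section Tangent

variable {ω : InfVolFermionState 2} {t' U μ n h ℓ u₀ : ℝ} {g : Site 2 → ℝ}

/-- **A tangent is a `μ`-floor.** If a canonical certificate at density `n` with filling multiplier `μ` proves
`ℓ + μ(m − n) ≤ e(1,t′,U,m)` at every interior density `m ∈ (0,2)` (RHS-parametric weak duality of the SAME dual: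
the filling enters the relaxation only through the right-hand sides of its density rows), then
`ℓ − μn ≤ p(1,t′,U,μ)`. [cite: Ruelle1969, §3.4] -/
theorem gcFloor_of_tangent (hU : 0 ≤ U)
    (htan : ∀ m : ℝ, 0 < m → m < 2 → ℓ + μ * (m - n) ≤ energyDensityTT' 1 t' U m) :
    ℓ - μ * n ≤ gcEnergyDensityTT' 1 t' U μ := by
  refine le_gcEnergyDensityTT'_of_Ioo 1 t' hU fun m hm0 hm2 => ?_
  have := htan m hm0 hm2
  linarith

/-- **The `μ`-pencil energy of a state of density `n`**: `E^{μ}_h(σ) = E^{0}_h(σ) − μ·n` — a cap `u₀` certified on the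
`μ = 0` pencil for a state of density exactly `n` is the cap `u₀ − μn` on the `μ`-pencil, at EVERY `μ`.
[cite: KomaTasaki1994, §1] -/
theorem meanEnergy_hubbardTTPrimeSourced_mu_eq (σ : InfVolFermionState 2) (hσn : σ.density = n) :
    σ.meanEnergy (hubbardTTPrimeSourcedInteraction 1 t' U μ g h) 1 =
      σ.meanEnergy (hubbardTTPrimeSourcedInteraction 1 t' U 0 g h) 1 - μ * n := by
  rw [meanEnergy_hubbardTTPrimeSourced, meanEnergy_hubbardTTPrimeSourced, hσn]
  ring

/-- **The `μ`-terms cancel** (same-density form). For a translation-invariant `ω` of density EXACTLY `n ∈ (0,2)` with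
`μ = 0`-pencil sourced energy `E^{0}_h(ω) ≤ u₀`, the tangent `ℓ + μ(m − n) ≤ e(m)` (all interior `m`) gives
`(ℓ − u₀)/(2h) ≤ Re ω(P₀^d)` — the floor VALUE of the canonical route (`TISourcedMinimiserChordFloor`), reached
through the grand-canonical floor at `μ` (`(ℓ − μn) − (u₀ − μn) = ℓ − u₀`). [cite: Griffiths1966, §II] [cite: Ruelle1969, §3.4] -/
theorem re_expect_localPairAt_ge_of_tangent_of_sourced_le_sameDensity (hω : ω.IsTranslationInvariant)
    (hU : 0 ≤ U) (hρ : ω.density = n) (hn0 : 0 < n) (hn2 : n < 2) (hh : 0 < h)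
    (htan : ∀ m : ℝ, 0 < m → m < 2 → ℓ + μ * (m - n) ≤ energyDensityTT' 1 t' U m)
    (hu : ω.meanEnergy (hubbardTTPrimeSourcedInteraction 1 t' U 0 dWaveFormFactor h) 1 ≤ u₀) :
    (ℓ - u₀) / (2 * h) ≤
      (ω.expect (pairRegion (insert 0 unitSteps) 0) (localPairAt (insert 0 unitSteps) dWaveFormFactor 0)).re := by
  have hc := gcFloor_of_tangent (t' := t') hU htan
  have hu' : ω.meanEnergy (hubbardTTPrimeSourcedInteraction 1 t' U μ dWaveFormFactor h) 1 ≤ u₀ - μ * n := by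
    rw [meanEnergy_hubbardTTPrimeSourced_mu_eq ω hρ]
    linarith
  have key := re_expect_localPairAt_ge_of_gcFloor_of_sourced_le hω hU (hρ ▸ hn0) (hρ ▸ hn2) hh hc hu'
  rwa [show ℓ - μ * n - (u₀ - μ * n) = ℓ - u₀ by ring] at key

end Tangent

/-! ### §3 ε-minimisers of the grand-canonical sourced energy -/

section Minimiser

variable {ω : InfVolFermionState 2} {t' U μ h c u ε : ℝ}

/-- **The ε-minimiser form, grand-canonical class.** If `ω` (translation invariant, density in `(0,2)`) ε-minimises
`E^{μ}_h` among the translation-invariant states of density in `(0,2)`, if SOME such state has `E^{μ}_h ≤ u` (the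
certified sourced cap), and `c ≤ p(1,t′,U,μ)`, then `(c − u − ε)/(2h) ≤ Re ω(P₀^d)`.
[cite: Griffiths1966, §II] [cite: KomaTasaki1994, §1] -/
theorem re_expect_localPairAt_ge_of_gcEpsMinimiser (hω : ω.IsTranslationInvariant) (hU : 0 ≤ U)
    (hρ0 : 0 < ω.density) (hρ2 : ω.density < 2) (hh : 0 < h)
    (hc : c ≤ gcEnergyDensityTT' 1 t' U μ)
    (hmin : ∀ ω' : InfVolFermionState 2, ω'.IsTranslationInvariant → 0 < ω'.density → ω'.density < 2 →
      ω.meanEnergy (hubbardTTPrimeSourcedInteraction 1 t' U μ dWaveFormFactor h) 1 ≤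
        ω'.meanEnergy (hubbardTTPrimeSourcedInteraction 1 t' U μ dWaveFormFactor h) 1 + ε)
    (hcap : ∃ σ : InfVolFermionState 2, σ.IsTranslationInvariant ∧ 0 < σ.density ∧ σ.density < 2 ∧
      σ.meanEnergy (hubbardTTPrimeSourcedInteraction 1 t' U μ dWaveFormFactor h) 1 ≤ u) :
    (c - u - ε) / (2 * h) ≤
      (ω.expect (pairRegion (insert 0 unitSteps) 0) (localPairAt (insert 0 unitSteps) dWaveFormFactor 0)).re := by
  obtain ⟨σ, hσ, hσ0, hσ2, hσu⟩ := hcap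
  have hu : ω.meanEnergy (hubbardTTPrimeSourcedInteraction 1 t' U μ dWaveFormFactor h) 1 ≤ u + ε :=
    (hmin σ hσ hσ0 hσ2).trans (by linarith)
  have h1 := re_expect_localPairAt_ge_of_gcFloor_of_sourced_le hω hU hρ0 hρ2 hh hc hu
  rwa [show c - (u + ε) = c - u - ε by ring] at h1

/-- **ε-minimisers exist** in the grand-canonical class: if some translation-invariant state has density in
`(0,2)`, then for every `ε > 0` there is a translation-invariant `ω` with density in `(0,2)` whose `Ψ`-mean energy is
within `ε` of every other's (the mean energy is bounded below by `−‖E_Ψ‖`, `abs_meanEnergy_le_norm`).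
[cite: BratteliRobinsonI1987, Prop. 2.3.11] -/
theorem exists_epsMinimiser_gcClass (Ψ : FermionInteraction 2)
    (hne : ∃ σ : InfVolFermionState 2, σ.IsTranslationInvariant ∧ 0 < σ.density ∧ σ.density < 2) (hε : 0 < ε) :
    ∃ ω : InfVolFermionState 2, ω.IsTranslationInvariant ∧ 0 < ω.density ∧ ω.density < 2 ∧
      ∀ ω' : InfVolFermionState 2, ω'.IsTranslationInvariant → 0 < ω'.density → ω'.density < 2 →
        ω.meanEnergy Ψ 1 ≤ ω'.meanEnergy Ψ 1 + ε := by
  classical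
  set S : Set ℝ := (fun σ : InfVolFermionState 2 => σ.meanEnergy Ψ 1) ''
    {σ | σ.IsTranslationInvariant ∧ 0 < σ.density ∧ σ.density < 2} with hS
  have hSne : S.Nonempty := by
    obtain ⟨σ, hσ, hσ0, hσ2⟩ := hne
    exact ⟨_, σ, ⟨hσ, hσ0, hσ2⟩, rfl⟩
  have hSbdd : BddBelow S := by
    refine ⟨-‖Ψ.meanEnergyObs 1‖, ?_⟩
    rintro _ ⟨σ, -, rfl⟩
    exact (abs_le.1 (σ.abs_meanEnergy_le_norm Ψ 1)).1
  obtain ⟨x, ⟨ω, ⟨hω, hω0, hω2⟩, rfl⟩, hlt⟩ := Real.lt_sInf_add_pos hSne hε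
  refine ⟨ω, hω, hω0, hω2, fun ω' hω' hω'0 hω'2 => ?_⟩
  have hle : sInf S ≤ ω'.meanEnergy Ψ 1 := csInf_le hSbdd ⟨ω', ⟨hω', hω'0, hω'2⟩, rfl⟩
  linarith

end Minimiser

/-! ### §4 The `(t′, U) = (0, 8)` instance at the tangent chemical potential of CERTIFIED #473 -/

section Anchor473

variable {ω : InfVolFermionState 2}

/-- **B1-U in the grand-canonical class at `μ₄₇₃ = 980464777135/2³⁹`.** For every translation-invariant `ω` with
density in `(0,2)` whose own sourced energy at chemical potential `μ₄₇₃` and field `h > 0` is `≤ u`, the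
grand-canonical reading of #473's certificate — the `μ`-floor
`hμ : ℓ₄₇₃ − (7/8)μ₄₇₃ ≤ gcEnergyDensityTT' 1 0 8 μ₄₇₃` (`= −2898708545185443623774215/2⁸⁰`,
`PinningFieldTangentChord.tangent473_intercept_eq`; a HYPOTHESIS: it is what the dual of #473 certifies at every
density, NOT the landed one-density node `Certificates.cert_r473_…`, which does not imply it) — gives
`((ℓ₄₇₃ − (7/8)μ₄₇₃) − u)/(2h) ≤ Re ω(P₀^d)`. With `u = u₀ − (7/8)μ₄₇₃` for a cap `u₀` certified on the `μ = 0` pencil at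
density `7/8` this is `(ℓ₄₇₃ − u₀)/(2h)`, the number of the canonical route. A finite-field RESPONSE floor at ONE
chemical potential; not an order parameter, not a phase word, nothing at `h → 0`. [cite: Griffiths1966, §II] -/
theorem re_expect_localPairAt_ge_anchor473_gc (hω : ω.IsTranslationInvariant)
    (hρ0 : 0 < ω.density) (hρ2 : ω.density < 2) {h u : ℝ} (hh : 0 < h)
    (hμ : (((-1012151804787154021296135 / 1208925819614629174706176 : ℚ) -
        7 / 8 * (980464777135 / 549755813888 : ℚ) : ℚ) : ℝ) ≤
      gcEnergyDensityTT' 1 0 8 ((980464777135 / 549755813888 : ℚ) : ℝ))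
    (hu : ω.meanEnergy (hubbardTTPrimeSourcedInteraction 1 0 8 ((980464777135 / 549755813888 : ℚ) : ℝ)
        dWaveFormFactor h) 1 ≤ u) :
    ((((-1012151804787154021296135 / 1208925819614629174706176 : ℚ) -
        7 / 8 * (980464777135 / 549755813888 : ℚ) : ℚ) : ℝ) - u) / (2 * h) ≤
      (ω.expect (pairRegion (insert 0 unitSteps) 0) (localPairAt (insert 0 unitSteps) dWaveFormFactor 0)).re :=
  re_expect_localPairAt_ge_of_gcFloor_of_sourced_le hω (by norm_num) hρ0 hρ2 hh hμ hu

/-- The same instance read against a `μ = 0`-pencil cap `u₀` on a state of density EXACTLY `7/8` (the cluster-mixture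
cap of the canonical route): `(ℓ₄₇₃ − u₀)/(2h) ≤ Re ω(P₀^d)` for every translation-invariant `ω` of density `7/8`
with `E^{0}_h(ω) ≤ u₀`, from the `μ₄₇₃`-floor — the two routes give the same number. [cite: Griffiths1966, §II] -/
theorem re_expect_localPairAt_ge_anchor473_gc_sameDensity (hω : ω.IsTranslationInvariant)
    (hρ : ω.density = 7 / 8) {h u₀ : ℝ} (hh : 0 < h)
    (hμ : (((-1012151804787154021296135 / 1208925819614629174706176 : ℚ) -
        7 / 8 * (980464777135 / 549755813888 : ℚ) : ℚ) : ℝ) ≤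
      gcEnergyDensityTT' 1 0 8 ((980464777135 / 549755813888 : ℚ) : ℝ))
    (hu : ω.meanEnergy (hubbardTTPrimeSourcedInteraction 1 0 8 0 dWaveFormFactor h) 1 ≤ u₀) :
    (((-1012151804787154021296135 / 1208925819614629174706176 : ℚ) : ℝ) - u₀) / (2 * h) ≤
      (ω.expect (pairRegion (insert 0 unitSteps) 0) (localPairAt (insert 0 unitSteps) dWaveFormFactor 0)).re := by
  have hu' : ω.meanEnergy (hubbardTTPrimeSourcedInteraction 1 0 8 ((980464777135 / 549755813888 : ℚ) : ℝ)
      dWaveFormFactor h) 1 ≤ u₀ - ((980464777135 / 549755813888 : ℚ) : ℝ) * (7 / 8) := by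
    rw [meanEnergy_hubbardTTPrimeSourced_mu_eq ω hρ]
    linarith
  have key := re_expect_localPairAt_ge_anchor473_gc hω (hρ ▸ by norm_num) (hρ ▸ by norm_num) hh hμ hu'
  have harith : ((((-1012151804787154021296135 / 1208925819614629174706176 : ℚ) -
        7 / 8 * (980464777135 / 549755813888 : ℚ) : ℚ) : ℝ) -
      (u₀ - ((980464777135 / 549755813888 : ℚ) : ℝ) * (7 / 8))) =
        (((-1012151804787154021296135 / 1208925819614629174706176 : ℚ) : ℝ) - u₀) := by
    push_cast
    ring
  rwa [harith] at key

end Anchor473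

end Summit.Ventures.CertifiedManyBodySolver.Observables

end
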